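import Literature.Analysis.FluidPDE.GeneralizedAxisymNS
import HarnessLib

/-!
# Hou–Li 2008: the one-dimensional axis model of axisymmetric Navier–Stokes with swirl
# (`u^θ = r u₁(z,t)`, `ω^θ = r ω₁`, `ψ^θ = r ψ₁`) and its global regularity

Topic `Literature/Analysis/FluidPDE`; definitions with bodies, one PROVED structural theorem and
one named fact (a result in print that the tree has not proved, `def … : Prop`, D-0014), typed for
the ns-blowup cell's self-similar census (SELFSIM-NOGO (M10): «the one exact 1-D reduction of
axisymmetric NS along the axis (Hou–Li 2008) is GLOBALLY REGULAR; its blow-ups need the advection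
weakened, which leaves NS» — KILLSHEET-B §3b v0.5: «M10 … has no tree decl»).

T. Y. Hou, C. Li, *Dynamic stability of the three-dimensional axisymmetric Navier–Stokes equations
with swirl*, Comm. Pure Appl. Math. 61 (2008) 661–697 (doi:10.1002/cpa.20212; references to the
journal pagination of the held copy, pp. 6–7 and 17–18):

* the **1D model** (22)–(24) (p. 6), in the Hou–Li variables `u₁ = u^θ/r`, `ω₁ = ω^θ/r`,
  `ψ₁ = ψ^θ/r` restricted to functions of `(z, t)`:
  `(u₁)ₜ + 2ψ₁ (u₁)_z = ν (u₁)_zz + 2 (ψ₁)_z u₁`,  `(ω₁)ₜ + 2ψ₁ (ω₁)_z = ν (ω₁)_zz + (u₁²)_z`,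
  `−(ψ₁)_zz = ω₁`;

> **Theorem 1** (p. 7). Let `u₁`, `ψ₁` and `ω₁` be the solution of the 1D model (22)–(24) and define
> `u(r, z, t) = r u₁(z, t)`, `ω(r, z, t) = r ω₁(z, t)`, `ψ(r, z, t) = r ψ₁(z, t)`. Then
> `(u, ω, ψ)` is an exact solution of the 3D Navier–Stokes equations.
>
> **Theorem 4** (p. 17). Assume that `ũ(z, 0)` and `ṽ(z, 0)` are in `C^m[0, 1]` with `m ≥ 1` and
> periodic with period `1`. Then the solution `(ũ, ṽ)` of the 1D model will be in `C^m[0, 1]` for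
> all times.

(`ũ = u₁`, `ṽ = −(ψ₁)_z`, p. 6; proof of Thm. 4, p. 18: the nonlinear quantity `ũ_z² + ṽ_z²`
satisfies the maximum principle (74) `‖ũ_z² + ṽ_z²‖_{L^∞} ≤ ‖(ũ₀)_z² + (ṽ₀)_z²‖_{L^∞}` "which holds
for both `ν = 0` and `ν > 0`", whence `‖ṽ‖_∞ ≤ C₀`, `‖ũ(t)‖_∞ ≤ ‖ũ₀‖_∞ e^{2C₀t}`, "the higher
order regularity follows from the standard estimates"; Thm. 3, p. 13, is the inviscid case in
Lagrangian form.)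

* `HouLiAxisModel S ν U Ω Ψ t z` — the three equations (22)–(24) at one point `(t, z)`;
  `HouLiAxisModel.IsClassicalSolutionOn S ν U Ω Ψ` — classical solutions on the time set `S`;
  `HouLiAxisModel.lift U` — the `r`-independent meridian profile `(r, z) ↦ U(t, z)`.
* `HouLiAxisModel.IsClassicalSolutionOn.generalizedAxisymNS_lift` — **Theorem 1 in Hou's
  variables, PROVED**: a classical solution of the 1D model, lifted as an `r`-independent profile,
  is a classical solution of the tree's `GeneralizedAxisymNS` system at `n = 3` (Hou 2026's
  `(u₁, ω₁, ψ₁)` reformulation of 3D axisymmetric Navier–Stokes with swirl, whose `n = 3` case IS the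
  Hou–Li 2008 reformulation: `GeneralizedAxisymNS.lean`, module docstring) — the exact-reduction
  content of Thm. 1; the dictionary `GeneralizedAxisymNS (n = 3)` ↔ `IsClassicalNSSolutionOn` is
  the route-level claim deliberately not stated in that file, and is not claimed here either.
* `houLi2008_axisModel_globalRegularity` — **Theorem 4** (with Thm. 3 for the mechanism at
  `ν = 0` NOT included: stated for `ν > 0`, the section's "viscous model") as a named fact, in
  existence form: smooth `1`-periodic data `(ũ₀, ψ̃₀)` launch a global smooth `z`-periodic classical
  solution of (22)–(24) with `U 0 = ũ₀`, `(Ψ 0)' = ψ̃₀'`.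

## Rendering (never stronger than print)

Profiles are `U Ω Ψ : ℝ → ℝ → ℝ`, time first (`U t z`), the convention of
`IsClassicalNSSolutionOn` / `GeneralizedAxisymNS`; `z`-derivatives are Mathlib's `deriv` of the
slice `U t`, the time derivative is the accepted one-sided `timeDerivWithin S`; joint smoothness is
the accepted `IsSmoothSpaceTimeOn S`.  The source `(u₁²)_z` is written `deriv (fun z => U t z ^ 2)`
as printed.  Thm. 4 is rendered as GLOBAL EXISTENCE of a smooth periodic solution from smooth
periodic data `ũ₀ = U 0`, `ṽ₀ = −(ψ̃₀)' = −(Ψ 0)'` for a smooth periodic potential `ψ̃₀` (so `ṽ₀` is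
smooth, periodic and of zero mean — exactly the printed data class; the gauge constant of `ψ̃` is
left free, and `ω₁(0) = −(ψ̃₀)''` by (24)), which the printed "the solution … will be in `C^m` for all times"
(global well-posedness in `C^m`, `m ≥ 1`; `C^∞` data give `C^∞` solutions by the standard
higher-order estimates quoted above) contains; the continuation form "no classical solution of the
1D model is maximal" would need the (elementary, unprinted) uniqueness of smooth periodic solutions
and is NOT asserted.  Viscosity `ν > 0`.

## Mathlib / tree search

Mathlib has no Navier–Stokes theory.  `lean search 'HouLi|houLi2008|axisModel'`: the Hou–Li
VARIABLES exist (`AxisymHouLiVariables.lean`: `angVelQuot`, `angVortQuot`, `radVelQuot`;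
`HouLiSpaceTime.lean`), and Hou's generalized system `GeneralizedAxisymNS` (n = 3 = Hou–Li's
reformulation) with its continuation vocabulary; no statement of the 1D model or of its global
regularity (2026-08-26).  Bib key `HouLi2007` = CPAM 61 (2008), doi:10.1002/cpa.20212 (the key
`HouLi2008` is the Physica D survey).

## References

* T. Y. Hou, C. Li, Comm. Pure Appl. Math. 61 (2008) 661–697: (22)–(24) p. 6, (29)–(31), Thm. 1
  p. 7, Thm. 3 p. 13, Thm. 4 pp. 17–18 with (72)–(74). [`HouLi2007`]
* T. Y. Hou, Found. Comput. Math. (2026) = arXiv:2405.10916, §2 p. 7 (the `n = 3` case of the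
  generalized system is the Hou–Li reformulation). [`Hou2026`]
-/

noncomputable section

open Set Function
open scoped ContDiff

namespace Literature.Analysis.FluidPDE

/-! ### The 1D model at a point and its classical solutions -/

/-- **The Hou–Li axis model (22)–(24) at the space–time point `(t, z)`** for the unknowns
`U = u₁`, `Ω = ω₁`, `Ψ = ψ₁ : ℝ → ℝ → ℝ` (time first), viscosity `ν`:
`Uₜ + 2Ψ U_z = ν U_zz + 2Ψ_z U`, `Ωₜ + 2Ψ Ω_z = ν Ω_zz + (U²)_z`, `−Ψ_zz = Ω`; time derivative
one-sided within the time set `S`. [cite: HouLi2007, (22)–(24) (p. 6)] -/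
structure HouLiAxisModel (S : Set ℝ) (ν : ℝ) (U Ω Ψ : ℝ → ℝ → ℝ) (t z : ℝ) : Prop where
  /-- (22): `(u₁)ₜ + 2ψ₁ (u₁)_z = ν (u₁)_zz + 2 (ψ₁)_z u₁`. -/
  u_eq : timeDerivWithin S U t z + 2 * Ψ t z * deriv (U t) z =
    ν * deriv (deriv (U t)) z + 2 * deriv (Ψ t) z * U t z
  /-- (23): `(ω₁)ₜ + 2ψ₁ (ω₁)_z = ν (ω₁)_zz + (u₁²)_z`. -/
  ω_eq : timeDerivWithin S Ω t z + 2 * Ψ t z * deriv (Ω t) z =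
    ν * deriv (deriv (Ω t)) z + deriv (fun z' => U t z' ^ 2) z
  /-- (24): `−(ψ₁)_zz = ω₁`. -/
  ψ_eq : -deriv (deriv (Ψ t)) z = Ω t z

namespace HouLiAxisModel

/-- **Classical solutions of the Hou–Li axis model on the time set `S`** (typically `Ico 0 T` or
`Ici 0`): `U, Ω, Ψ` jointly `C^∞` on `S × ℝ` and (22)–(24) at every `t ∈ S`, `z ∈ ℝ`.
[cite: HouLi2007, (22)–(24) (p. 6) and Thm. 4 (classical C^m solutions)] -/
structure IsClassicalSolutionOn (S : Set ℝ) (ν : ℝ) (U Ω Ψ : ℝ → ℝ → ℝ) : Prop where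
  /-- `U` is jointly smooth on `S × ℝ`. -/
  smooth_U : IsSmoothSpaceTimeOn S U
  /-- `Ω` is jointly smooth on `S × ℝ`. -/
  smooth_Ω : IsSmoothSpaceTimeOn S Ω
  /-- `Ψ` is jointly smooth on `S × ℝ`. -/
  smooth_Ψ : IsSmoothSpaceTimeOn S Ψ
  /-- The equations (22)–(24) hold on `S × ℝ`. -/
  equations : ∀ t ∈ S, ∀ z : ℝ, HouLiAxisModel S ν U Ω Ψ t z

/-- The `r`-independent meridian profile `(t, (r, z)) ↦ U(t, z)` built from an axis-model unknown
(Hou–Li's `u₁(z, t)` read as a function on the meridian half-plane, Thm. 1).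
[cite: HouLi2007, Thm. 1 (p. 7)] -/
def lift (U : ℝ → ℝ → ℝ) : ℝ → ℝ × ℝ → ℝ := fun t q => U t q.2

/-- Unfolding `lift`. [cite: HouLi2007, Thm. 1 (p. 7)] -/
@[simp] theorem lift_apply (U : ℝ → ℝ → ℝ) (t : ℝ) (q : ℝ × ℝ) : lift U t q = U t q.2 := rfl

/-! ### Calculus of `r`-independent profiles -/

section Calculus

variable {f : ℝ → ℝ}

/-- An `r`-independent profile built from a differentiable function has the Fréchet derivative
`(a, b) ↦ f'(z) b`. [cite: HouLi2007, Thm. 1 (p. 7) ("can be verified directly by substituting")] -/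
theorem hasFDerivAt_comp_snd (hf : Differentiable ℝ f) (q : ℝ × ℝ) :
    HasFDerivAt (fun q' : ℝ × ℝ => f q'.2)
      ((fderiv ℝ f q.2).comp (ContinuousLinearMap.snd ℝ ℝ ℝ)) q :=
  (hf q.2).hasFDerivAt.comp q hasFDerivAt_snd

/-- `∂ᵣ` of an `r`-independent profile vanishes. [cite: HouLi2007, Thm. 1 (p. 7)] -/
theorem derivR_comp_snd (hf : Differentiable ℝ f) :
    derivR (fun q : ℝ × ℝ => f q.2) = fun _ => 0 := by
  funext q
  rw [derivR_apply, (hasFDerivAt_comp_snd hf q).fderiv]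
  simp

/-- `∂_z` of an `r`-independent profile is the lift of the derivative. [cite: HouLi2007, Thm. 1 (p. 7)] -/
theorem derivZ_comp_snd (hf : Differentiable ℝ f) :
    derivZ (fun q : ℝ × ℝ => f q.2) = fun q => deriv f q.2 := by
  funext q
  rw [derivZ_apply, (hasFDerivAt_comp_snd hf q).fderiv]
  simp

/-- Hou's operator on an `r`-independent smooth profile: `L_n f = f''`. [cite: HouLi2007, (22)–(24) vs. Hou2026 §2 p. 7] -/
theorem lap_comp_snd (n : ℝ) (hf : ContDiff ℝ ∞ f) (q : ℝ × ℝ) :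
    GeneralizedAxisymNS.lap n (fun q' : ℝ × ℝ => f q'.2) q = deriv (deriv f) q.2 := by
  have hd : Differentiable ℝ f := hf.differentiable (by simp)
  have hd' : Differentiable ℝ (deriv f) := by
    have h1 : ContDiff ℝ ∞ (deriv f) := by simpa using hf.iterate_deriv 1
    exact h1.differentiable (by simp)
  unfold GeneralizedAxisymNS.lap
  rw [derivR_comp_snd hd, derivZ_comp_snd hd]
  rw [derivZ_comp_snd hd']
  simp [derivR]

end Calculus

/-! ### Theorem 1 in Hou's variables (proved) -/

variable {S : Set ℝ} {ν : ℝ} {U Ω Ψ : ℝ → ℝ → ℝ}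

/-- Joint smoothness lifts from `S × ℝ` to `S × ℝ²`. [cite: HouLi2007, Thm. 1 (p. 7)] -/
theorem isSmoothSpaceTimeOn_lift (h : IsSmoothSpaceTimeOn S U) : IsSmoothSpaceTimeOn S (lift U) := by
  have hφ : ContDiff ℝ ∞ (fun p : ℝ × (ℝ × ℝ) => (p.1, p.2.2)) := by fun_prop
  have hmaps : MapsTo (fun p : ℝ × (ℝ × ℝ) => (p.1, p.2.2)) (S ×ˢ univ) (S ×ˢ univ) :=
    fun p hp => ⟨hp.1, mem_univ _⟩
  have : uncurry (lift U) = uncurry U ∘ fun p : ℝ × (ℝ × ℝ) => (p.1, p.2.2) := by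
    funext p; rfl
  unfold IsSmoothSpaceTimeOn
  rw [this]
  exact h.comp hφ.contDiffOn hmaps

/-- The time derivative of the lift is the lift of the time derivative (both are one-sided
derivatives of the same scalar function of `t`). [cite: HouLi2007, Thm. 1 (p. 7)] -/
theorem timeDerivWithin_lift (S : Set ℝ) (U : ℝ → ℝ → ℝ) (t : ℝ) (q : ℝ × ℝ) :
    timeDerivWithin S (lift U) t q = timeDerivWithin S U t q.2 := rfl

/-- **Hou–Li 2008, Theorem 1, in the Hou–Li variables (exact reduction): a classical solution of
the axis model (22)–(24), lifted as an `r`-independent profile, is a classical solution of the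
`(u₁, ω₁, ψ₁)` form of the 3D axisymmetric Navier–Stokes equations with swirl** — the tree's
`GeneralizedAxisymNS` system at `n = 3` (`u^r = −rψ₁,z`, `u^z = 2ψ₁ + rψ₁,r`, operators
`∂_rr + (3/r)∂_r + ∂_zz`), on the same time set and with the same viscosity.  For an
`r`-independent profile `∂ᵣ ≡ 0`, so `u^r ∂ᵣ ≡ 0`, `u^z = 2ψ₁`, `L₃ = ∂_zz`, and the three
equations of `GeneralizedAxisymNS` collapse literally to (22)–(24) ("can be verified directly by
substituting (32) into the 3D axisymmetric Navier–Stokes equations").  The identification of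
`GeneralizedAxisymNS` at `n = 3` with `IsClassicalNSSolutionOn` for `u = u^r e_r + r u₁ e_θ + u^z e_z`
is not part of this statement (see `GeneralizedAxisymNS.toVelocity`).
[cite: HouLi2007, Thm. 1 (p. 7) with (22)–(24); Hou2026, §2 p. 7 (n = 3 is the Hou–Li reformulation)] -/
theorem IsClassicalSolutionOn.generalizedAxisymNS_lift (h : IsClassicalSolutionOn S ν U Ω Ψ) :
    GeneralizedAxisymNS.IsClassicalSolutionOn S 3 ν (lift U) (lift Ω) (lift Ψ) where
  smooth_u₁ := isSmoothSpaceTimeOn_lift h.smooth_U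
  smooth_ω₁ := isSmoothSpaceTimeOn_lift h.smooth_Ω
  smooth_ψ₁ := isSmoothSpaceTimeOn_lift h.smooth_Ψ
  even_u₁ _ _ _ _ := rfl
  even_ω₁ _ _ _ _ := rfl
  even_ψ₁ _ _ _ _ := rfl
  equations t ht q _ := by
    have hU : ContDiff ℝ ∞ (U t) := h.smooth_U.contDiff_slice ht
    have hΩ : ContDiff ℝ ∞ (Ω t) := h.smooth_Ω.contDiff_slice ht
    have hΨ : ContDiff ℝ ∞ (Ψ t) := h.smooth_Ψ.contDiff_slice ht
    have hUd : Differentiable ℝ (U t) := hU.differentiable (by simp)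
    have hΩd : Differentiable ℝ (Ω t) := hΩ.differentiable (by simp)
    have hΨd : Differentiable ℝ (Ψ t) := hΨ.differentiable (by simp)
    have hU2d : Differentiable ℝ (fun z => U t z ^ 2) := hUd.pow 2
    have eq := h.equations t ht q.2
    -- the lifted slices are the `r`-independent profiles of the slices
    have eU : lift U t = fun q' : ℝ × ℝ => U t q'.2 := rfl
    have eΩ : lift Ω t = fun q' : ℝ × ℝ => Ω t q'.2 := rfl
    have eΨ : lift Ψ t = fun q' : ℝ × ℝ => Ψ t q'.2 := rfl
    have eU2 : (fun q' : ℝ × ℝ => lift U t q' ^ 2) = fun q' : ℝ × ℝ => (fun z => U t z ^ 2) q'.2 := rfl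
    refine ⟨?_, ?_, ?_⟩
    · -- (22)
      rw [timeDerivWithin_lift, GeneralizedAxisymNS.radialVel, GeneralizedAxisymNS.axialVel, eU, eΨ,
        lap_comp_snd 3 hU, derivR_comp_snd hUd, derivZ_comp_snd hUd, derivR_comp_snd hΨd,
        derivZ_comp_snd hΨd]
      simp only
      have := eq.u_eq
      linear_combination this
    · -- (23)
      rw [timeDerivWithin_lift, GeneralizedAxisymNS.radialVel, GeneralizedAxisymNS.axialVel, eΩ, eΨ,
        eU2, lap_comp_snd 3 hΩ, derivR_comp_snd hΩd, derivZ_comp_snd hΩd, derivR_comp_snd hΨd,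
        derivZ_comp_snd hΨd, derivZ_comp_snd hU2d]
      simp only
      have := eq.ω_eq
      linear_combination this
    · -- (24)
      rw [eΨ, lap_comp_snd 3 hΨ]
      simpa using eq.ψ_eq

end HouLiAxisModel

/-! ### Theorem 4 (global regularity of the axis model) as a named fact -/

/-- **Hou–Li 2008, Theorem 4 (global regularity of the 1D axis model with viscosity).**  "Assume
that `ũ(z, 0)` and `ṽ(z, 0)` are in `C^m[0, 1]` with `m ≥ 1` and periodic with period `1`. Then the
solution `(ũ, ṽ)` of the 1D model will be in `C^m[0, 1]` for all times" (`ũ = u₁`, `ṽ = −(ψ₁)_z`;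
§4 "Global well-posedness of the 1D viscous model"; mechanism: the maximum principle (74) for
`ũ_z² + ṽ_z²`).  Rendered (module docstring) as global existence: for `ν > 0` and smooth
`1`-periodic data `ũ₀`, `ψ̃₀` there is a classical solution `(U, Ω, Ψ)` of (22)–(24) on
`[0, ∞) × ℝ`, `1`-periodic in `z` at all times, with `U 0 = ũ₀` and `−(Ψ 0)' = −ψ̃₀' = ṽ₀` (the
printed data are `(ũ₀, ṽ₀)`; `ψ̃` is determined by `ṽ = −ψ̃_z` up to the Galilean gauge constant,
so only the derivative of `Ψ 0` is prescribed; `Ω 0 = −ψ̃₀''` by (24)).  The exact 1D reduction of axisymmetric Navier–Stokes along the axis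
therefore never blows up from such data — SELFSIM-NOGO (M10).
[cite: HouLi2007, Thm. 4 (pp. 17–18, with (72)–(74)); §4 title] -/
def houLi2008_axisModel_globalRegularity : Prop :=
  ∀ ν : ℝ, 0 < ν → ∀ (U₀ Ψ₀ : ℝ → ℝ), ContDiff ℝ ∞ U₀ → ContDiff ℝ ∞ Ψ₀ →
    Periodic U₀ 1 → Periodic Ψ₀ 1 →
    ∃ U Ω Ψ : ℝ → ℝ → ℝ, HouLiAxisModel.IsClassicalSolutionOn (Ici 0) ν U Ω Ψ ∧
      (∀ t : ℝ, 0 ≤ t → Periodic (U t) 1 ∧ Periodic (Ω t) 1 ∧ Periodic (Ψ t) 1) ∧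
      U 0 = U₀ ∧ ∀ z : ℝ, deriv (Ψ 0) z = deriv Ψ₀ z

/-! ### API -/

namespace houLi2008_axisModel_globalRegularity

/-- **Theorem 4 lifted by Theorem 1**: from smooth `1`-periodic axis data the `(u₁, ω₁, ψ₁)`-form
of axisymmetric Navier–Stokes (`GeneralizedAxisymNS`, `n = 3`) has a GLOBAL classical solution —
the `r`-independent lift of the global solution of the axis model; in particular this family of
exact (infinite-energy, `u^θ = r u₁`) solutions of the reformulated system exhibits no finite-time
blow-up (SELFSIM-NOGO (M10)). [cite: HouLi2007, Thm. 4 with Thm. 1] -/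
theorem exists_global_generalizedAxisymNS (h : houLi2008_axisModel_globalRegularity) {ν : ℝ}
    (hν : 0 < ν) {U₀ Ψ₀ : ℝ → ℝ} (hU₀ : ContDiff ℝ ∞ U₀) (hΨ₀ : ContDiff ℝ ∞ Ψ₀)
    (hU₀p : Periodic U₀ 1) (hΨ₀p : Periodic Ψ₀ 1) :
    ∃ u₁ ω₁ ψ₁ : ℝ → ℝ × ℝ → ℝ, GeneralizedAxisymNS.IsClassicalSolutionOn (Ici 0) 3 ν u₁ ω₁ ψ₁ ∧
      ∀ q : ℝ × ℝ, u₁ 0 q = U₀ q.2 := by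
  obtain ⟨U, Ω, Ψ, hsol, -, hU0, -⟩ := h ν hν U₀ Ψ₀ hU₀ hΨ₀ hU₀p hΨ₀p
  exact ⟨HouLiAxisModel.lift U, HouLiAxisModel.lift Ω, HouLiAxisModel.lift Ψ,
    hsol.generalizedAxisymNS_lift, fun q => by simp [hU0]⟩

/-- Hence, for every `T > 0`, a global solution from such data restricts to a classical solution on
`[0, T)` that extends smoothly past `T` (`GeneralizedAxisymNS.HasSmoothExtensionPast`): the axis
model produces no maximal solution with finite lifespan among the solutions it launches.
[cite: HouLi2007, Thm. 4 with Thm. 1] -/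
theorem exists_hasSmoothExtensionPast (h : houLi2008_axisModel_globalRegularity) {ν : ℝ}
    (hν : 0 < ν) {U₀ Ψ₀ : ℝ → ℝ} (hU₀ : ContDiff ℝ ∞ U₀) (hΨ₀ : ContDiff ℝ ∞ Ψ₀)
    (hU₀p : Periodic U₀ 1) (hΨ₀p : Periodic Ψ₀ 1) (T : ℝ) :
    ∃ u₁ ω₁ ψ₁ : ℝ → ℝ × ℝ → ℝ, GeneralizedAxisymNS.IsClassicalSolutionOn (Ico 0 T) 3 ν u₁ ω₁ ψ₁ ∧
      GeneralizedAxisymNS.HasSmoothExtensionPast 3 ν u₁ ω₁ ψ₁ T ∧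
      ∀ q : ℝ × ℝ, u₁ 0 q = U₀ q.2 := by
  obtain ⟨u₁, ω₁, ψ₁, hsol, hdata⟩ := exists_global_generalizedAxisymNS h hν hU₀ hΨ₀ hU₀p hΨ₀p
  have hT' : GeneralizedAxisymNS.IsClassicalSolutionOn (Ico 0 (T + 1)) 3 ν u₁ ω₁ ψ₁ :=
    hsol.mono Ico_subset_Ici_self (uniqueDiffOn_Ico 0 (T + 1))
  refine ⟨u₁, ω₁, ψ₁, hT'.mono (Ico_subset_Ico_right (by linarith)) (uniqueDiffOn_Ico 0 T),
    hT'.hasSmoothExtensionPast (by linarith), hdata⟩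

end houLi2008_axisModel_globalRegularity

end Literature.Analysis.FluidPDE

end
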